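import Summits.BirchSwinnertonDyer.BirchSwinnertonDyer.Theorems.CMKolyvaginAtInertTwoGenusDefectBSDConsistencyAtTwo
import Summits.BirchSwinnertonDyer.BirchSwinnertonDyer.Theorems.CMKolyvaginAtInertTwoGenusDefectConsequencesAtTwo
import HarnessLib

/-!
# Route `CMKolyvaginAtInertTwo`, crux `CMKolyvaginExactAtInertTwo` (stmt-BirchSwinnertonDyer-24277) —
# BSD₂ OF THE PAIR FORCES GENUS DIVISIBILITY OF THE HEEGNER POINT: `Σ ≤ 2M₀ + 1`, so `y_K ∈ 2E(K)` whenever `Σ ≥ 3`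

Seat `bsd-line-cmk2-p1` g21 (cell `bsd-print-cf2`), `--supports stmt-BirchSwinnertonDyer-24277` (helper; closes nothing by name).
THEOREMS ONLY (no definition, no named fact, no `sorry`).  `BSDp W 2` is a HYPOTHESIS: consistency statements, BSD is NOT proved by this.
Companion of `…GenusDefectBSDConsistencyAtTwo` (p759429): there §1 gave `BSDp Wd 2 → BSDp W 2 → #Ш(E_K)(2) = 2^{2M₀}`; with g20's
count-identity bound `2^{Σ} ≤ #Ш(E_K)(2)·2` (`KolyvaginGenusTwo.two_pow_sum_defect_le_card_sha_two_baseChange_mul_two`) this file reads off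
* `sum_defect_le_two_mul_add_one_of_bsdp_of_printedInputs` — `Σ ≤ 2M₀ + 1` (g20's `sum_defect_le_of_cmKolyvaginExact` with BSD₂ of the pair in
  place of the crux and NO certificate);
* `one_le_exponent_of_bsdp_of_three_le_sum_defect_of_printedInputs` — for `Σ ≥ 3`: `M₀ ≥ 1` and `y_K = P(1) ∈ 2E(K[1])`: the trivial certificate
  `n = 1` of 24277 / 24648 / 28176 never exists there (and by p759429 §2 no DEEP one either) — what is left for Kolyvagin's conjecture in the
  cruxes' «`P(n) ∉ 2E(K[n])`» form on `Σ ≥ 3` are SHALLOW products only; if the Jetchev-type bound `m_∞ ≥ (Σ−1)/2` holds at `p = 2` they fail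
  too, and 24648 / 28177 want the same «`Σ ≤ 1`» restatement as 24277 (harmless for `closes`, which evaluates them at the supplied field only).
References: [Kramer1981] Prop. 3; [Milne1972ArithmeticAV] Thm. 1; [GrossLMS1991] §2 Conj. (2.2); [Jetchev2008] Thm. 1.1 (shape of the statement).
-/

set_option autoImplicit false
-- the Theorems namespace of this sub repeats the summit name by design (D-0017 nested layout)
set_option linter.dupNamespace false

noncomputable section

open scoped Classical

open WeierstrassCurve NumberField Literature.NumberTheory.EllipticCurves
  Literature.NumberTheory.EllipticCurves.ModularForms
  Literature.NumberTheory.EllipticCurves.Rank1Residual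
  Summit.BirchSwinnertonDyer.Rank1Residual
open Literature.NumberTheory.EllipticCurves.GrossLMS1991 (prop37_2_reductionCongruence_inert)

namespace Summit.BirchSwinnertonDyer.BirchSwinnertonDyer.Theorems.KolyvaginGenusTwo

/-- **`BSD₂(E^{(d_K)}) ∧ BSD₂(E) ⟹ Σ ≤ 2M₀ + 1`** on the habitat (CM, `2` inert, `ρ̄_{E,2}` onto, `r_an = 1`, odd Tamagawa product; `K`
imaginary quadratic with odd `d_K ≠ −3`, Heegner; odd Manin constant; `y_K` non-torsion with `2^{M₀} ∥ y_K`), modulo GZ / GZK / modularity /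
Milne: file `…BSDConsistencyAtTwo` §1's `#Ш(E_K)(2) = 2^{2M₀}` against g20's count-identity bound `2^{Σ} ≤ #Ш(E_K)(2)·2`.  (g20's `sum_defect_le_of_cmKolyvaginExact` had the
crux 24277 as hypothesis instead of BSD₂; no certificate is needed here.)  The Heegner point of a Heegner field with many primes `q`,
`E(ℚ_q)[2] ≠ 0`, is highly `2`-divisible: `M₀ ≥ (Σ − 1)/2` — the genus analogue at `p = 2` of Jetchev's global divisibility by Tamagawa numbers.
[cite: Kramer1981, Prop. 3] [cite: Milne1972ArithmeticAV, Thm. 1] [cite: GrossLMS1991, §2 Conj. (2.2)] [cite: Jetchev2008, Thm. 1.1 (shape)] -/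
theorem sum_defect_le_two_mul_add_one_of_bsdp_of_printedInputs
    (hGZ : ∀ (N : ℕ) [NeZero N] (W : WeierstrassCurve ℚ) (K : Type) [Field K] [NumberField K], gross_zagier N W K)
    (hGZK : rank_eq_analyticRank_of_analyticRank_le_one) (hmod : hasEntireLFunction_rat)
    (hMilneC : Milne1972.bsdQuotient_baseChange_quadratic_anyModel)
    (W : WeierstrassCurve ℚ) [W.IsElliptic] [W.IsGloballyMinimal] [NeZero (W.conductorNorm ℤ)]
    (hCM : W.HasCM) (hin : Rank1Residual.CMInert W 2) (hρ2 : W.HasSurjectiveModNGaloisRep 2) (hr : W.analyticRank = 1)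
    (hT : Odd W.tamagawaProduct) (K : Type) [Field K] [NumberField K] (hIQ : IsImaginaryQuadratic K)
    (hodd : Odd (NumberField.discr K)) (h3 : NumberField.discr K ≠ -3) (hHe : SatisfiesHeegnerHypothesis (W.conductorNorm ℤ) K)
    (Dt : ModularParametrizationData W (W.conductorNorm ℤ)) (hc : Odd Dt.c) (β : ℤ) (ι : K →+* ℂ) (d₁ : KolyvaginHeegnerData Dt β ι 1)
    (hy : ¬ IsOfFinAddOrder d₁.derivedPoint) (M₀ : ℕ)
    (hM₀ : ∃ Q : (W.baseChange (ringClassField K ι 1)).toAffine.Point, ((2 ^ M₀ : ℕ) : ℤ) • Q = d₁.derivedPoint)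
    (hndiv : ¬ ∃ Q : (W.baseChange (ringClassField K ι 1)).toAffine.Point, ((2 ^ (M₀ + 1) : ℕ) : ℤ) • Q = d₁.derivedPoint)
    (Wd : WeierstrassCurve ℚ) [Wd.IsElliptic] [Wd.IsGloballyMinimal]
    (hWd : ∃ C : VariableChange ℚ, C • W.quadraticTwist (NumberField.discr K : ℚ) = Wd)
    (hBd : BSDp Wd 2) (hBW : BSDp W 2) :
    ∑ q ∈ (NumberField.discr K).natAbs.primeFactors,
        ((if jacobiSym W.Δ.num q = -1 then 1 else 0) +
          (if jacobiSym W.Δ.num q = 1 ∧ Even (W.frobeniusTrace q) then 2 else 0)) ≤ 2 * M₀ + 1 := by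
  have h2 := two_pow_sum_defect_le_card_sha_two_baseChange_mul_two W hGZ hGZK hmod hMilneC hCM hin hρ2 hIQ hodd hHe Dt β ι d₁ hy
  have hB := card_primaryComponent_sha_two_baseChange_eq_pow_of_bsdp_of_printedInputs hGZ hGZK hmod hMilneC W hρ2 hr hT K hIQ hodd h3 hHe Dt
    hc β ι d₁ hy M₀ hM₀ hndiv Wd hWd hBd hBW
  rw [hB, ← pow_succ] at h2
  exact (Nat.pow_le_pow_iff_right one_lt_two).mp h2

/-- **`BSD₂(E^{(d_K)}) ∧ BSD₂(E) ∧ Σ ≥ 3 ⟹ y_K ∈ 2E(K[1])`** (`M₀ ≥ 1`): under BSD₂ of the pair the trivial certificate `n = 1` of the cruxes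
24277 / 24648 / 28176 never exists over a Heegner field with `Σ ≥ 3` — there `Ш(E_K)[2] ≠ 0` (g20) AND the Heegner point is imprimitive; with
`…BSDConsistencyAtTwo` §2, no DEEP primitive product exists either, so Kolyvagin's conjecture in the crux's «`P(n) ∉ 2E(K[n])`» form can only hold there through
SHALLOW products (open; if the Jetchev-type bound `m_∞ ≥ (Σ−1)/2` holds at `p = 2`, it fails, and 24648 / 28177 want the same «Σ ≤ 1»
restatement as 24277 — harmless for `closes`, which evaluates them only at the supplied field).  Modulo the four prints. [cite: Kramer1981, Prop. 3]
[cite: GrossLMS1991, §2 Conj. (2.2)] [cite: Jetchev2008, Thm. 1.1 (shape)] -/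
theorem one_le_exponent_of_bsdp_of_three_le_sum_defect_of_printedInputs
    (hGZ : ∀ (N : ℕ) [NeZero N] (W : WeierstrassCurve ℚ) (K : Type) [Field K] [NumberField K], gross_zagier N W K)
    (hGZK : rank_eq_analyticRank_of_analyticRank_le_one) (hmod : hasEntireLFunction_rat)
    (hMilneC : Milne1972.bsdQuotient_baseChange_quadratic_anyModel)
    (W : WeierstrassCurve ℚ) [W.IsElliptic] [W.IsGloballyMinimal] [NeZero (W.conductorNorm ℤ)]
    (hCM : W.HasCM) (hin : Rank1Residual.CMInert W 2) (hρ2 : W.HasSurjectiveModNGaloisRep 2) (hr : W.analyticRank = 1)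
    (hT : Odd W.tamagawaProduct) (K : Type) [Field K] [NumberField K] (hIQ : IsImaginaryQuadratic K)
    (hodd : Odd (NumberField.discr K)) (h3 : NumberField.discr K ≠ -3) (hHe : SatisfiesHeegnerHypothesis (W.conductorNorm ℤ) K)
    (Dt : ModularParametrizationData W (W.conductorNorm ℤ)) (hc : Odd Dt.c) (β : ℤ) (ι : K →+* ℂ) (d₁ : KolyvaginHeegnerData Dt β ι 1)
    (hy : ¬ IsOfFinAddOrder d₁.derivedPoint) (M₀ : ℕ)
    (hM₀ : ∃ Q : (W.baseChange (ringClassField K ι 1)).toAffine.Point, ((2 ^ M₀ : ℕ) : ℤ) • Q = d₁.derivedPoint)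
    (hndiv : ¬ ∃ Q : (W.baseChange (ringClassField K ι 1)).toAffine.Point, ((2 ^ (M₀ + 1) : ℕ) : ℤ) • Q = d₁.derivedPoint)
    (Wd : WeierstrassCurve ℚ) [Wd.IsElliptic] [Wd.IsGloballyMinimal]
    (hWd : ∃ C : VariableChange ℚ, C • W.quadraticTwist (NumberField.discr K : ℚ) = Wd)
    (hBd : BSDp Wd 2) (hBW : BSDp W 2)
    (hS3 : 3 ≤ ∑ q ∈ (NumberField.discr K).natAbs.primeFactors,
        ((if jacobiSym W.Δ.num q = -1 then 1 else 0) +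
          (if jacobiSym W.Δ.num q = 1 ∧ Even (W.frobeniusTrace q) then 2 else 0))) :
    1 ≤ M₀ ∧ ∃ Q : (W.baseChange (ringClassField K ι 1)).toAffine.Point, (2 : ℤ) • Q = d₁.derivedPoint := by
  have h := sum_defect_le_two_mul_add_one_of_bsdp_of_printedInputs hGZ hGZK hmod hMilneC W hCM hin hρ2 hr hT K hIQ hodd h3 hHe Dt hc β ι d₁
    hy M₀ hM₀ hndiv Wd hWd hBd hBW
  have hM : 1 ≤ M₀ := by omega
  refine ⟨hM, ?_⟩
  obtain ⟨Q, hQ⟩ := hM₀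
  refine ⟨((2 ^ (M₀ - 1) : ℕ) : ℤ) • Q, ?_⟩
  rw [smul_smul, ← hQ]
  congr 1
  have h2 : ((2 ^ M₀ : ℕ) : ℤ) = (2 : ℤ) * ((2 ^ (M₀ - 1) : ℕ) : ℤ) := by
    conv_lhs => rw [← Nat.sub_add_cancel hM, pow_succ]
    push_cast
    ring
  exact h2.symm

end Summit.BirchSwinnertonDyer.BirchSwinnertonDyer.Theorems.KolyvaginGenusTwo

end
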